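import Mathlib
import HarnessLib
import Summits.HubbardSuperconductivity.HubbardSuperconductivity.Theorems.WeakCouplingBCSDefsKlCertTPrime
import Summits.HubbardSuperconductivity.HubbardSuperconductivity.Theorems.WeakCouplingBCSDefsKlCertB1gWinDRecord
import Summits.HubbardSuperconductivity.HubbardSuperconductivity.Theorems.WeakCouplingBCSDefsKlCertB1gD020CellRecord

/-!
# WeakCouplingBCS — KL certificate: higher-order remainder vs certified second-order margin (explicit `U₀`, statements first)

The CHANNEL-MARGIN lane's purpose line (cell gate-hubbard-kl, risk-register item 1: «higher-order terms vs certified channel margin,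
explicit `U₀ > 0`») in the tree's vocabulary, kit-free and statements-first (pen (R49x) GO «U0-SELECTION-ALGEBRA», conditions (1)–(4)):

* §1 ONE HYPOTHESIS KIND `KLChannelRemainderBound tp a b Λ C U₁` (a parametrised `Prop` family — a SLOT, not a fact): an abstract full
  channel pairing strength `Λ χ μ U` differs from the second-order Kohn–Luttinger channel bottom `channelInf ε_{t′} μ U χ`
  (`Literature…KohnLuttinger`) by at most `C·U³`, uniformly for `μ ∈ [a, b]`, `0 < U ≤ U₁` and every `D₄` channel.  The SECOND-ORDER LEAD is
  NOT restated: it is the tree's `KLB1gDominatesTP tp a b γ` (`…Theorems.WeakCouplingBCSDefsKlCertTPrime`), the conclusion of every certified row.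
* §2 the explicit threshold `klU0 γ C U₁ = min(1, U₁, γ/2C)` (`C ≤ 0` read as no constraint: `min(1, U₁)`).
* §3 THE SELECTION-SURVIVAL LEMMA (pure real algebra): `KLB1gDominatesTP` + `KLChannelRemainderBound` give
  `Λ B1g μ U + (γ − 2CU)·U² ≤ Λ χ μ U` (`μ ∈ [a, b]`, `0 < U < 1`, `U ≤ U₁`, `χ ≠ B1g`); strict `B1g` selection whenever `2CU < γ`, in
  particular for `0 < U < klU0 γ C U₁`, and `0 < klU0` when `γ, U₁ > 0`.
* §4 THE RECORD SLOT: a `t′ = 0` record `c : KLCert` accepted by the checker, modulo its enclosures, enters BY NAME (`γ = c.gamma`, no numeral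
  re-typed): generic `klB1g_full_lt_of_checkB1gD_of_remainder`, and the window record `klCertB1gWinD` / the `δ ≈ 0.20` cell `klCertB1gD020Cell`
  through their landed `_window_U` theorems.  A `t′` row (`KLB1gDominatesTP t′ …`, e.g. `klCertB1gTPm03D0125_dominates_of_E`) slots into §3 directly.

Honest framing: NOTHING here bounds the higher orders — `C` (`= C₃(δ)`, the post-freeze certified third-order / ladder constant) and `U₁`
are hypotheses and `Λ` is an abstract function (the renormalised effective interaction of the FKT-scale analysis is not an object of the
tree); the lemma only converts «certified second-order margin `γ`» + «a certified remainder constant `C`» into the explicit threshold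
`U₀ = min(1, U₁, γ/2C)`.  Register expectation 0.00.  RECORD ≠ DECIDED; nothing about K₃ or the window; a Kohn–Luttinger `O(U²)` channel
statement is not ODLRO and nothing here proves superconductivity in the Hubbard model.  Filed `--supports stmt-HubbardSuperconductivity-0158`.

References: S. Raghu, S. A. Kivelson, D. J. Scalapino, Phys. Rev. B 81 (2010) 224505, §II (7), (12)–(13) and §IV (higher-order
corrections `O(U³)`); W. Kohn, J. M. Luttinger, Phys. Rev. Lett. 15 (1965) 524.
-/

noncomputable section

-- the tree's namespace `Summit.<Summit>.<Problem>.Theorems` repeats the summit name by design (D-0017)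
set_option linter.dupNamespace false

namespace Summit.HubbardSuperconductivity.HubbardSuperconductivity.Theorems

open Literature.MathematicalPhysics.QuantumLattice CwKLChiralWindow

/-! ### §1 The hypothesis kind: channel-uniform higher-order remainder bound -/

/-- **Higher-order remainder bound — HYPOTHESIS SLOT** (parametrised `Prop` family; asserts nothing; `C = C₃(δ)` is the post-freeze kit
constant of the U0-TABLE, `U₁` its range of validity).  `Λ χ μ U` — an abstract full channel pairing strength of the `t`–`t′` band — differs
from the second-order Kohn–Luttinger channel bottom `channelInf ε_{t′} μ U χ` by at most `C·U³`, for every `μ ∈ [a, b]`, every `0 < U ≤ U₁`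
and every `D₄` channel `χ`. [cite: RaghuKivelsonScalapino2010, §IV] -/
def KLChannelRemainderBound (tp a b : ℝ) (Λ : D4Irrep → ℝ → ℝ → ℝ) (C U₁ : ℝ) : Prop :=
  ∀ μ ∈ Set.Icc a b, ∀ U ∈ Set.Ioc (0 : ℝ) U₁, ∀ χ : D4Irrep,
    |Λ χ μ U - channelInf (squareDispersion 1 tp) μ U χ| ≤ C * U ^ 3

/-! ### §2 The explicit threshold `U₀` -/

/-- **The explicit coupling threshold** `U₀(γ, C, U₁) = min(1, U₁, γ/2C)` for `C > 0`, and `min(1, U₁)` for `C ≤ 0` (no constraint from a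
vanishing remainder). [folklore] -/
def klU0 (γ C U₁ : ℝ) : ℝ := if 0 < C then min (min 1 U₁) (γ / (2 * C)) else min 1 U₁

/-- `U₀ ≤ 1`. [folklore] -/
theorem klU0_le_one (γ C U₁ : ℝ) : klU0 γ C U₁ ≤ 1 := by
  unfold klU0; split_ifs
  · exact (min_le_left _ _).trans (min_le_left _ _)
  · exact min_le_left _ _

/-- `U₀ ≤ U₁`. [folklore] -/
theorem klU0_le_U1 (γ C U₁ : ℝ) : klU0 γ C U₁ ≤ U₁ := by
  unfold klU0; split_ifs
  · exact (min_le_left _ _).trans (min_le_right _ _)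
  · exact min_le_right _ _

/-- Below `U₀` the remainder is beaten: `0 ≤ C`, `0 < γ`, `U < U₀ ⇒ 2CU < γ`. [folklore] -/
theorem two_mul_C_mul_lt_of_lt_klU0 {γ C U₁ U : ℝ} (hC : 0 ≤ C) (hγ : 0 < γ) (hU : U < klU0 γ C U₁) : 2 * C * U < γ := by
  unfold klU0 at hU
  split_ifs at hU with h
  · have h1 : U < γ / (2 * C) := lt_of_lt_of_le hU (min_le_right _ _)
    have h2 := (lt_div_iff₀ (by positivity : (0 : ℝ) < 2 * C)).1 h1
    linarith
  · have hC0 : C = 0 := le_antisymm (not_lt.1 h) hC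
    rw [hC0]; linarith

/-- `U₀ > 0` as soon as `γ > 0` and `U₁ > 0` (any `C`). [folklore] -/
theorem klU0_pos {γ C U₁ : ℝ} (hγ : 0 < γ) (hU₁ : 0 < U₁) : 0 < klU0 γ C U₁ := by
  unfold klU0; split_ifs with h
  · exact lt_min (lt_min one_pos hU₁) (div_pos hγ (by positivity))
  · exact lt_min one_pos hU₁

/-! ### §3 The selection-survival lemma -/

/-- **Selection survives the higher orders, pointwise form.** If the second-order `B1g` bottom dominates by `γU²` on `[a, b]`
(`KLB1gDominatesTP tp a b γ`) and the full strengths are within `C·U³` of the second-order bottoms (`KLChannelRemainderBound`), then for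
`μ ∈ [a, b]`, `0 < U < 1`, `U ≤ U₁` and `χ ≠ B1g`: `Λ B1g μ U + (γ − 2CU)·U² ≤ Λ χ μ U` (no sign condition on `C`).
[cite: RaghuKivelsonScalapino2010, §II (13), §IV] -/
theorem klB1g_full_le_of_dominates_of_remainder {tp a b γ C U₁ : ℝ} {Λ : D4Irrep → ℝ → ℝ → ℝ}
    (hD : KLB1gDominatesTP tp a b γ) (hR : KLChannelRemainderBound tp a b Λ C U₁)
    {μ : ℝ} (hμ : μ ∈ Set.Icc a b) {U : ℝ} (hU0 : 0 < U) (hU1 : U < 1) (hUU₁ : U ≤ U₁)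
    {χ : D4Irrep} (hχ : χ ≠ D4Irrep.B1g) :
    Λ D4Irrep.B1g μ U + (γ - 2 * C * U) * U ^ 2 ≤ Λ χ μ U := by
  have h1 := abs_le.1 (hR μ hμ U ⟨hU0, hUU₁⟩ D4Irrep.B1g)
  have h2 := abs_le.1 (hR μ hμ U ⟨hU0, hUU₁⟩ χ)
  have h3 := hD μ hμ U ⟨hU0, hU1⟩ χ hχ
  nlinarith [h1.2, h2.1, h3]

/-- **Strict `B1g` selection while the remainder is beaten** (`2CU < γ`): for `μ ∈ [a, b]`, `0 < U < 1`, `U ≤ U₁`, `χ ≠ B1g`,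
`Λ B1g μ U < Λ χ μ U`. [cite: RaghuKivelsonScalapino2010, §II (13), §IV] -/
theorem klB1g_full_lt_of_dominates_of_remainder {tp a b γ C U₁ : ℝ} {Λ : D4Irrep → ℝ → ℝ → ℝ}
    (hD : KLB1gDominatesTP tp a b γ) (hR : KLChannelRemainderBound tp a b Λ C U₁)
    {μ : ℝ} (hμ : μ ∈ Set.Icc a b) {U : ℝ} (hU0 : 0 < U) (hU1 : U < 1) (hUU₁ : U ≤ U₁) (hCU : 2 * C * U < γ)
    {χ : D4Irrep} (hχ : χ ≠ D4Irrep.B1g) : Λ D4Irrep.B1g μ U < Λ χ μ U := by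
  have h := klB1g_full_le_of_dominates_of_remainder hD hR hμ hU0 hU1 hUU₁ hχ
  have hm : 0 < (γ - 2 * C * U) * U ^ 2 := mul_pos (by linarith) (by positivity)
  linarith

/-- **Strict `B1g` selection below the explicit `U₀`** (`0 ≤ C`, `0 < γ`): for `μ ∈ [a, b]`, `0 < U < klU0 γ C U₁` and `χ ≠ B1g`,
`Λ B1g μ U < Λ χ μ U`. [cite: RaghuKivelsonScalapino2010, §II (13), §IV] -/
theorem klB1g_full_lt_of_lt_klU0 {tp a b γ C U₁ : ℝ} {Λ : D4Irrep → ℝ → ℝ → ℝ}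
    (hD : KLB1gDominatesTP tp a b γ) (hR : KLChannelRemainderBound tp a b Λ C U₁) (hC : 0 ≤ C) (hγ : 0 < γ)
    {μ : ℝ} (hμ : μ ∈ Set.Icc a b) {U : ℝ} (hU0 : 0 < U) (hU : U < klU0 γ C U₁)
    {χ : D4Irrep} (hχ : χ ≠ D4Irrep.B1g) : Λ D4Irrep.B1g μ U < Λ χ μ U :=
  klB1g_full_lt_of_dominates_of_remainder hD hR hμ hU0 (lt_of_lt_of_le hU (klU0_le_one γ C U₁))
    (lt_of_lt_of_le hU (klU0_le_U1 γ C U₁)).le (two_mul_C_mul_lt_of_lt_klU0 hC hγ hU) hχ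

/-! ### §4 The record slot: certified rows enter by name -/

/-- **Generic `t′ = 0` record slot.** A record `c : KLCert` accepted by the multiplicity-aware checker (`c.checkB1gD = true`, a kernel
decision for every landed record) whose certified enclosures hold, a remainder constant `0 ≤ C` valid up to `U₁` on its window, and
`0 < c.gamma`: strict `B1g` selection for every `μ ∈ [c.mub, c.mua]`, `0 < U < klU0 c.gamma C U₁`, `χ ≠ B1g`.
[cite: RaghuKivelsonScalapino2010, §III Fig. 2, §IV] -/
theorem klB1g_full_lt_of_checkB1gD_of_remainder (c : KLCert) (hc : c.checkB1gD = true) (hE : c.EnclosuresB1gTP 0)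
    {Λ : D4Irrep → ℝ → ℝ → ℝ} {C U₁ : ℝ} (hR : KLChannelRemainderBound 0 ((c.mub : ℚ) : ℝ) ((c.mua : ℚ) : ℝ) Λ C U₁)
    (hC : 0 ≤ C) (hγ : 0 < ((c.gamma : ℚ) : ℝ)) {μ : ℝ} (hμ : μ ∈ Set.Icc ((c.mub : ℚ) : ℝ) ((c.mua : ℚ) : ℝ))
    {U : ℝ} (hU0 : 0 < U) (hU : U < klU0 ((c.gamma : ℚ) : ℝ) C U₁) {χ : D4Irrep} (hχ : χ ≠ D4Irrep.B1g) :
    Λ D4Irrep.B1g μ U < Λ χ μ U :=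
  klB1g_full_lt_of_lt_klU0 (klB1gDominatesTP_zero_of_checkB1gD c hc hE) hR hC hγ hμ hU0 hU hχ

/-- The window record's margin is positive: `klCertB1gWinD.gamma = 17751/2²⁰ > 0`. [folklore] -/
theorem klCertB1gWinD_gamma_pos : 0 < ((klCertB1gWinD.gamma : ℚ) : ℝ) := by
  have h : klCertB1gWinD.gamma = 17751 / 1048576 := rfl
  rw [h]; norm_num

/-- **The `t′ = 0` WINDOW RECORD slots in by name**: on `μ ∈ [−0.1775, −0.0750]` (record `klCertB1gWinD`, `γ = 17751/2²⁰`, modulo its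
certified enclosures — `klCertB1gWinD_window_U`), a remainder constant `0 ≤ C` valid up to `U₁` gives strict `B1g` selection for
`0 < U < klU0 γ C U₁`. [cite: RaghuKivelsonScalapino2010, §III Fig. 2, §IV] -/
theorem klB1g_full_lt_WinD_of_remainder (hE : klCertB1gWinD.EnclosuresB1g) {Λ : D4Irrep → ℝ → ℝ → ℝ} {C U₁ : ℝ}
    (hR : KLChannelRemainderBound 0 ((klCertB1gWinD.mub : ℚ) : ℝ) ((klCertB1gWinD.mua : ℚ) : ℝ) Λ C U₁) (hC : 0 ≤ C)
    {μ : ℝ} (hμ : μ ∈ Set.Icc ((klCertB1gWinD.mub : ℚ) : ℝ) ((klCertB1gWinD.mua : ℚ) : ℝ))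
    {U : ℝ} (hU0 : 0 < U) (hU : U < klU0 ((klCertB1gWinD.gamma : ℚ) : ℝ) C U₁) {χ : D4Irrep} (hχ : χ ≠ D4Irrep.B1g) :
    Λ D4Irrep.B1g μ U < Λ χ μ U :=
  klB1g_full_lt_of_lt_klU0 (klCertB1gWinD_window_U hE) hR hC klCertB1gWinD_gamma_pos hμ hU0 hU hχ

/-- The `δ ≈ 0.20` cell record's margin is positive: `klCertB1gD020Cell.gamma = 27103/2²⁰ > 0`. [folklore] -/
theorem klCertB1gD020Cell_gamma_pos : 0 < ((klCertB1gD020Cell.gamma : ℚ) : ℝ) := by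
  have h : klCertB1gD020Cell.gamma = 27103 / 1048576 := rfl
  rw [h]; norm_num

/-- **The `δ ≈ 0.20` CELL RECORD slots in by name**: on `μ ∈ [−0.42918, −0.4242]` (record `klCertB1gD020Cell`, `γ = 27103/2²⁰`, modulo
its certified enclosures — `klCertB1gD020Cell_window_U`), a remainder constant `0 ≤ C` valid up to `U₁` gives strict `B1g` selection for
`0 < U < klU0 γ C U₁`. [cite: RaghuKivelsonScalapino2010, §III Fig. 2, §IV] -/
theorem klB1g_full_lt_D020Cell_of_remainder (hE : klCertB1gD020Cell.EnclosuresB1g) {Λ : D4Irrep → ℝ → ℝ → ℝ} {C U₁ : ℝ}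
    (hR : KLChannelRemainderBound 0 ((klCertB1gD020Cell.mub : ℚ) : ℝ) ((klCertB1gD020Cell.mua : ℚ) : ℝ) Λ C U₁) (hC : 0 ≤ C)
    {μ : ℝ} (hμ : μ ∈ Set.Icc ((klCertB1gD020Cell.mub : ℚ) : ℝ) ((klCertB1gD020Cell.mua : ℚ) : ℝ))
    {U : ℝ} (hU0 : 0 < U) (hU : U < klU0 ((klCertB1gD020Cell.gamma : ℚ) : ℝ) C U₁) {χ : D4Irrep} (hχ : χ ≠ D4Irrep.B1g) :
    Λ D4Irrep.B1g μ U < Λ χ μ U :=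
  klB1g_full_lt_of_lt_klU0 (klCertB1gD020Cell_window_U hE) hR hC klCertB1gD020Cell_gamma_pos hμ hU0 hU hχ

end Summit.HubbardSuperconductivity.HubbardSuperconductivity.Theorems
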